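import Mathlib.NumberTheory.Padics.RingHoms
import Mathlib.GroupTheory.Torsion
import Mathlib.GroupTheory.Index
import Mathlib.GroupTheory.SpecificGroups.Cyclic
import Mathlib.RingTheory.Ideal.Norm.AbsNorm
import HarnessLib

/-!
# The `ℤ_p`-line lemma: a group with a finite-index subgroup `≅ ℤ_p` and no `p`-torsion is
# `ℤ_p × (finite p'-torsion)`, and `[G : p^k G + ℤQ] = p^{min(k, v_p Ψ(Q))}`
# (cell `b2b-bsdres`, sub-cell `multr1-p2`, gen 15 — pure algebra behind the local index at `p`)

HONEST FRAMING (verbatim, cell `b2b-bsdres`): the goal of the cell is to DELETE the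
COMBINATION-SHAPED residual classes for ALL analytic-rank `≤ 1` curves over `ℚ` — "full BSD
formula for every rank `≤ 1` curve in class `C`" assembled STRICTLY from published theorems — so
that the rank-`≤ 1` remainder becomes exactly the CONSTRUCTION-SHAPED classes, which are TYPED
(missing-input Props), NOT attempted; this is not "finishing BSD". Research route `p2` for class
X11b; no claim beyond the stated class; nothing booked; X11b stays CONSTRUCTION-SHAPED. One definition with a body (`psi`, the `ℤ_p`-coordinate) and theorems; no `sorry`; no
named fact.

## Content (namespace `Summit.BirchSwinnertonDyer.Rank1Residual.X11b.LocalIndex`)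

Let `G` be an additive abelian group, `E ≤ G` a subgroup of finite index `N` with `φ : E ≃+ ℤ_p`.

* `psi E φ : G →+ ℤ_p`, `Ψ(g) = φ(N • g)`; `psi_apply_of_mem` (`Ψ = N·φ` on `E`); `psi_eq_zero_iff`
  (`Ψ g = 0 ↔ g` has finite order: `E ≅ ℤ_p` is torsion-free).
* No `p`-torsion: `coprime_addOrderOf`, `mem_range_nsmul_pow_of_isOfFinAddOrder` (torsion `⊆ p^kG`),
  `not_dvd_card_torsion` (`p ∤ #T`, Cauchy). `ℤ_p`: `index_span_pow` (`[ℤ_p : p^mℤ_p] = p^m`),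
  `range_nsmul_sup_zmultiples_eq` (`p^kℤ_p + ℤx = p^{min(k, v(x))}ℤ_p`).
* **`psi_surjective`** (no `p`-torsion ⟹ `Ψ` ONTO: `[ℤ_p : Ψ(G)] = p^i`, `Ψ⁻¹(p^{v_p N}ℤ_p) = E + T`,
  `#T = p^i N/p^{v_p N}`, `p ∤ #T ⟹ i = 0`) and **`index_range_nsmul_sup_zmultiples_eq`**:
  `[G : p^k G + ℤQ] = p^{min(k, v_p(Ψ Q))}` for `Q` of infinite order.
Consumer: `BDPRouteLocalIndex.lean` (`G = E(ℚ_p)`, `E = E⁽²⁾(ℚ_p)`): the local index of Castella 2018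
(calcul) / JSW 2017 (7.1.5) — input (d) of route p2 / atom (P6) of route R1.

References: [SilvermanAEC2009] VII.6.3; [Castella2018] proof of Thm. 2.3 (calcul); [JetchevSkinnerWan2017] (7.1.5).
-/

noncomputable section

open scoped Classical

namespace Summit.BirchSwinnertonDyer.Rank1Residual.X11b.LocalIndex

variable {p : ℕ} [Fact p.Prime]
/-! ## §2 The `ℤ_p`-line lemma: a group with a finite-index subgroup `≅ ℤ_p` and no `p`-torsion -/

section PadicLine

variable {G : Type*} [AddCommGroup G] (E : AddSubgroup G) [hE : E.FiniteIndex] (φ : E ≃+ ℤ_[p])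

/-- **`Ψ(g) = φ([G:E] • g)`**: the `ℤ_p`-coordinate of a group `G` along a finite-index subgroup
`E ≅ ℤ_p` (the multiple `[G:E] • g` lies in `E`). [folklore] -/
def psi : G →+ ℤ_[p] where
  toFun g := φ ⟨E.index • g, E.nsmul_index_mem g⟩
  map_zero' := by
    rw [← map_zero φ]
    congr 1
    exact Subtype.ext (nsmul_zero _)
  map_add' g h := by
    rw [← map_add]
    congr 1
    exact Subtype.ext (nsmul_add _ _ _)

omit hE in
/-- Unfolding `psi`. [folklore] -/
theorem psi_apply (g : G) : psi E φ g = φ ⟨E.index • g, E.nsmul_index_mem g⟩ := rfl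
omit hE in
/-- On `E`, `Ψ = [G:E] · φ`. [folklore] -/
theorem psi_apply_of_mem {g : G} (hg : g ∈ E) : psi E φ g = (E.index : ℤ_[p]) * φ ⟨g, hg⟩ := by
  rw [psi_apply, ← nsmul_eq_mul, ← map_nsmul]
  rfl

omit hE in
/-- `E ≅ ℤ_p` is torsion-free: an element of `E` of finite order is `0`. [folklore] -/
theorem eq_zero_of_mem_of_isOfFinAddOrder (φ : E ≃+ ℤ_[p]) {g : G} (hg : g ∈ E)
    (hfin : IsOfFinAddOrder g) : g = 0 := by
  obtain ⟨n, hn, hng⟩ := (isOfFinAddOrder_iff_nsmul_eq_zero).mp hfin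
  have h1 : n • φ ⟨g, hg⟩ = 0 := by
    rw [← map_nsmul]
    convert map_zero φ
    exact Subtype.ext hng
  have h2 : φ ⟨g, hg⟩ = 0 := by
    rcases (smul_eq_zero.mp h1) with h | h
    · exact absurd h hn.ne'
    · exact h
  have h3 : (⟨g, hg⟩ : E) = 0 := φ.map_eq_zero_iff.mp h2
  exact congrArg Subtype.val h3

/-- `Ψ(g) = 0` iff `g` has finite order. [folklore] -/
theorem psi_eq_zero_iff (g : G) : psi E φ g = 0 ↔ IsOfFinAddOrder g := by
  constructor
  · intro h
    rw [psi_apply, φ.map_eq_zero_iff] at h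
    have h' : E.index • g = 0 := congrArg Subtype.val h
    exact isOfFinAddOrder_iff_nsmul_eq_zero.mpr ⟨E.index, Nat.pos_of_ne_zero hE.index_ne_zero, h'⟩
  · intro h
    have hfin : IsOfFinAddOrder (E.index • g) := h.nsmul
    have h0 := eq_zero_of_mem_of_isOfFinAddOrder E φ (E.nsmul_index_mem g) hfin
    rw [psi_apply, ← map_zero φ]
    congr 1
    exact Subtype.ext h0

end PadicLine

section NoPTorsion

variable {G : Type*} [AddCommGroup G] (hiv : ∀ g : G, p • g = 0 → g = 0)
include hiv

/-- Without `p`-torsion, every element of finite order has order prime to `p`. [folklore] -/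
theorem coprime_addOrderOf {g : G} (hg : IsOfFinAddOrder g) : (addOrderOf g).Coprime p := by
  rw [Nat.Coprime, Nat.gcd_comm]
  by_contra h
  have hp : p ∣ addOrderOf g := by
    rcases (Nat.Prime.eq_one_or_self_of_dvd (Fact.out : p.Prime) _ (Nat.gcd_dvd_left p (addOrderOf g)))
      with h1 | h1
    · exact absurd h1 h
    · rw [← h1]; exact Nat.gcd_dvd_right _ _
  obtain ⟨m, hm⟩ := hp
  have hpos : 0 < addOrderOf g := hg.addOrderOf_pos
  have hm0 : m ≠ 0 := by rintro rfl; rw [mul_zero] at hm; omega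
  have h1 : p • (m • g) = 0 := by rw [← mul_nsmul', ← hm]; exact addOrderOf_nsmul_eq_zero g
  have h2 : m • g = 0 := hiv _ h1
  have h3 : addOrderOf g ∣ m := addOrderOf_dvd_of_nsmul_eq_zero h2
  have h4 : m < addOrderOf g := by
    rw [hm]; exact lt_mul_left (Nat.pos_of_ne_zero hm0) (Fact.out : p.Prime).one_lt
  exact absurd (Nat.le_of_dvd (Nat.pos_of_ne_zero hm0) h3) (not_le.mpr h4)

/-- Without `p`-torsion, every torsion element is a `p^k`-th multiple (it is `p^k • (a • g)` for
`a p^k ≡ 1` modulo its order). [folklore] -/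
theorem mem_range_nsmul_pow_of_isOfFinAddOrder (k : ℕ) {g : G} (hg : IsOfFinAddOrder g) :
    g ∈ (nsmulAddMonoidHom (p ^ k) : G →+ G).range := by
  have hcop : (p ^ k).Coprime (addOrderOf g) := Nat.Coprime.pow_left k (coprime_addOrderOf hiv hg).symm
  rcases Nat.eq_or_lt_of_le (Nat.one_le_iff_ne_zero.mpr hg.addOrderOf_pos.ne') with h1 | h1
  · -- order `1`: `g = 0`
    have : g = 0 := by rw [← AddMonoid.addOrderOf_eq_one_iff, ← h1]
    exact ⟨0, by rw [this, map_zero]⟩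
  · obtain ⟨a, -, ha⟩ := Nat.exists_mul_mod_eq_one_of_coprime hcop h1
    refine ⟨a • g, ?_⟩
    rw [nsmulAddMonoidHom_apply, ← mul_nsmul', ← Nat.div_add_mod (p ^ k * a) (addOrderOf g), ha,
      add_nsmul, one_nsmul, mul_comm, mul_nsmul', addOrderOf_nsmul_eq_zero, nsmul_zero, zero_add]

end NoPTorsion

/-! ## §3 Subgroups of `ℤ_p`: `p^m ℤ_p` has index `p^m`; `p^k ℤ_p + ℤ·x = p^{min(k, v(x))} ℤ_p` -/

section Zp

/-- `[ℤ_p : p^m ℤ_p] = p^m`. [folklore] -/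
theorem index_span_pow (m : ℕ) :
    (Ideal.span {(p : ℤ_[p]) ^ m}).toAddSubgroup.index = p ^ m := by
  change Submodule.cardQuot (Ideal.span {(p : ℤ_[p]) ^ m}) = p ^ m
  rw [Submodule.cardQuot_apply]
  have hsurj : Function.Surjective (PadicInt.toZModPow m : ℤ_[p] →+* ZMod (p ^ m)) :=
    ZMod.ringHom_surjective _
  have e : ℤ_[p] ⧸ Ideal.span {(p : ℤ_[p]) ^ m} ≃+* ZMod (p ^ m) :=
    (Ideal.quotEquivOfEq (PadicInt.ker_toZModPow m).symm).trans
      (RingHom.quotientKerEquivOfSurjective hsurj)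
  rw [Nat.card_congr e.toEquiv, Nat.card_zmod]

/-- Membership in `p^m ℤ_p`: `y ∈ (p^m)` iff `y = p^m z`. [folklore] -/
theorem mem_span_pow_iff (m : ℕ) (y : ℤ_[p]) :
    y ∈ (Ideal.span {(p : ℤ_[p]) ^ m}).toAddSubgroup ↔ ∃ z : ℤ_[p], y = (p : ℤ_[p]) ^ m * z := by
  rw [Submodule.mem_toAddSubgroup, Ideal.mem_span_singleton']
  constructor
  · rintro ⟨z, rfl⟩; exact ⟨z, mul_comm _ _⟩
  · rintro ⟨z, rfl⟩; exact ⟨z, mul_comm _ _⟩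

/-- A non-zero `x ∈ ℤ_p` of valuation `≥ m` lies in `p^m ℤ_p`. [folklore] -/
theorem mem_span_pow_of_le_valuation {m : ℕ} {x : ℤ_[p]} (hx : x ≠ 0) (hm : m ≤ x.valuation) :
    x ∈ (Ideal.span {(p : ℤ_[p]) ^ m}).toAddSubgroup := by
  rw [mem_span_pow_iff]
  refine ⟨(PadicInt.unitCoeff hx : ℤ_[p]) * (p : ℤ_[p]) ^ (x.valuation - m), ?_⟩
  conv_lhs => rw [PadicInt.unitCoeff_spec hx, ← Nat.add_sub_cancel' hm, pow_add]
  ring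

/-- **`p^k ℤ_p + ℤ·x = p^{min(k, v(x))} ℤ_p`** for `x ≠ 0`. [folklore] -/
theorem range_nsmul_sup_zmultiples_eq {x : ℤ_[p]} (hx : x ≠ 0) (k : ℕ) :
    (nsmulAddMonoidHom (p ^ k) : ℤ_[p] →+ ℤ_[p]).range ⊔ AddSubgroup.zmultiples x =
      (Ideal.span {(p : ℤ_[p]) ^ min k x.valuation}).toAddSubgroup := by
  set m := min k x.valuation with hm
  apply le_antisymm
  · -- `⊆`
    refine sup_le ?_ ?_
    · rintro _ ⟨y, rfl⟩
      rw [nsmulAddMonoidHom_apply, nsmul_eq_mul, mem_span_pow_iff]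
      refine ⟨(p : ℤ_[p]) ^ (k - m) * y, ?_⟩
      rw [← mul_assoc, ← pow_add, Nat.add_sub_cancel' (min_le_left _ _), Nat.cast_pow]
    · rw [AddSubgroup.zmultiples_le]
      exact mem_span_pow_of_le_valuation hx (min_le_right _ _)
  · -- `⊇`
    intro y hy
    obtain ⟨z, rfl⟩ := (mem_span_pow_iff m _).mp hy
    by_cases hkv : k ≤ x.valuation
    · -- `m = k`: `p^k z ∈ p^k ℤ_p`
      have hmk : m = k := min_eq_left hkv
      refine AddSubgroup.mem_sup_left ⟨z, ?_⟩
      rw [nsmulAddMonoidHom_apply, nsmul_eq_mul, hmk, Nat.cast_pow]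
    · -- `m = v(x) < k`: `x = p^m u`, `z u⁻¹ = a + p^{k-m} w` with `a ∈ ℕ`
      have hmv : m = x.valuation := min_eq_right (le_of_not_ge hkv)
      set u := PadicInt.unitCoeff hx with hu
      have hxu : x = (u : ℤ_[p]) * (p : ℤ_[p]) ^ m := by rw [hmv]; exact PadicInt.unitCoeff_spec hx
      set z' : ℤ_[p] := z * ((u⁻¹ : ℤ_[p]ˣ) : ℤ_[p]) with hz'
      obtain hw := PadicInt.appr_spec (k - m) z'
      obtain ⟨w, hw'⟩ := Ideal.mem_span_singleton'.mp hw
      -- `p^m z = (appr z') • x + p^k (u w)`·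
      have hz : z = (u : ℤ_[p]) * ((PadicInt.appr z' (k - m) : ℕ) : ℤ_[p]) +
          (u : ℤ_[p]) * (w * (p : ℤ_[p]) ^ (k - m)) := by
        have h1 : z = (u : ℤ_[p]) * z' := by
          rw [hz', mul_comm z, ← mul_assoc, Units.mul_inv, one_mul]
        rw [h1, ← mul_add]
        congr 1
        rw [hw']
        ring
      have hkm : m + (k - m) = k := Nat.add_sub_cancel' (by rw [hmv]; exact le_of_lt (lt_of_not_ge hkv))
      rw [hz, mul_add, AddSubgroup.mem_sup]
      refine ⟨(p : ℤ_[p]) ^ m * ((u : ℤ_[p]) * (w * (p : ℤ_[p]) ^ (k - m))), ⟨(u : ℤ_[p]) * w, ?_⟩,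
        (p : ℤ_[p]) ^ m * ((u : ℤ_[p]) * ((PadicInt.appr z' (k - m) : ℕ) : ℤ_[p])), ?_, ?_⟩
      · rw [nsmulAddMonoidHom_apply, nsmul_eq_mul, Nat.cast_pow,
          show ((p : ℤ_[p])) ^ k = (p : ℤ_[p]) ^ m * (p : ℤ_[p]) ^ (k - m) from by rw [← pow_add, hkm]]
        ring
      · rw [AddSubgroup.mem_zmultiples_iff]
        refine ⟨(PadicInt.appr z' (k - m) : ℤ), ?_⟩
        rw [hxu, zsmul_eq_mul]; push_cast; ring
      · ring

/-- **`[ℤ_p : p^k ℤ_p + ℤ·x] = p^{min(k, v(x))}`** for `x ≠ 0`. [folklore] -/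
theorem index_range_nsmul_sup_zmultiples {x : ℤ_[p]} (hx : x ≠ 0) (k : ℕ) :
    ((nsmulAddMonoidHom (p ^ k) : ℤ_[p] →+ ℤ_[p]).range ⊔ AddSubgroup.zmultiples x).index =
      p ^ min k x.valuation := by
  rw [range_nsmul_sup_zmultiples_eq hx k, index_span_pow]

end Zp

/-! ## §4 `Ψ` is onto `ℤ_p` (no `p`-torsion) and the index formula `[G : p^kG + ℤQ] = p^{min(k, v(Ψ Q))}` -/

section Surj

variable {G : Type*} [AddCommGroup G] (E : AddSubgroup G) [hE : E.FiniteIndex] (φ : E ≃+ ℤ_[p])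
variable (hiv : ∀ g : G, p • g = 0 → g = 0)

omit hE in
/-- `E ⊓ T = ⊥`: the torsion subgroup meets `E ≅ ℤ_p` trivially. [folklore] -/
theorem addSubgroupOf_torsion_eq_bot (φ : E ≃+ ℤ_[p]) :
    E.addSubgroupOf (AddCommGroup.torsion G) = ⊥ := by
  rw [eq_bot_iff]
  rintro ⟨t, ht⟩ htE
  rw [AddSubgroup.mem_bot]
  apply Subtype.ext
  exact eq_zero_of_mem_of_isOfFinAddOrder E φ htE ht

/-- The torsion subgroup is finite: it embeds into `G ⧸ E`. [folklore] -/
theorem finite_torsion (φ : E ≃+ ℤ_[p]) : Finite (AddCommGroup.torsion G) := by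
  haveI : Finite (G ⧸ E) := AddSubgroup.finite_quotient_of_finiteIndex
  refine Finite.of_injective (fun t : AddCommGroup.torsion G ↦ ((t : G) : G ⧸ E)) ?_
  rintro ⟨x, hx⟩ ⟨y, hy⟩ hxy
  apply Subtype.ext
  have hmem : -x + y ∈ E := QuotientAddGroup.eq.mp hxy
  have hfin : IsOfFinAddOrder (-x + y) := (AddCommGroup.torsion G).add_mem ((AddCommGroup.torsion G).neg_mem hx) hy
  have h := eq_zero_of_mem_of_isOfFinAddOrder E φ hmem hfin
  rwa [neg_add_eq_zero] at h

include hiv in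
omit hE in
/-- Without `p`-torsion, `p ∤ #T`. [folklore] -/
theorem not_dvd_card_torsion [Finite (AddCommGroup.torsion G)] :
    ¬ p ∣ Nat.card (AddCommGroup.torsion G) := by
  intro hdvd
  haveI := Fintype.ofFinite (AddCommGroup.torsion G)
  rw [Nat.card_eq_fintype_card] at hdvd
  obtain ⟨t, ht⟩ := exists_prime_addOrderOf_dvd_card p hdvd
  have h1 : p • (t : G) = 0 := by
    rw [← AddSubgroup.coe_nsmul, ← ht, addOrderOf_nsmul_eq_zero, AddSubgroup.coe_zero]
  have h2 : (t : G) = 0 := hiv _ h1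
  have h3 : t = 0 := Subtype.ext h2
  rw [h3, addOrderOf_zero] at ht
  exact (Fact.out : p.Prime).one_lt.ne' ht.symm

include hiv in
/-- **`Ψ : G → ℤ_p` is ONTO** when `G` has no `p`-torsion: with `N = [G:E] = p^j N'` (`p ∤ N'`),
`Ψ(G) ⊇ Ψ(E) = p^jℤ_p` so `[ℤ_p : Ψ(G)] = p^i`; `Ψ⁻¹(p^jℤ_p) = E + T` (`T` torsion `= ker Ψ`), so
`N = [G : E + T]·[E + T : E] = p^{j-i} #T`, `#T = p^i N'`, and `p ∤ #T` forces `i = 0`. [folklore] -/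
theorem psi_surjective : Function.Surjective (psi E φ) := by
  classical
  set f := psi E φ with hf
  set N := E.index with hN
  have hN0 : N ≠ 0 := hE.index_ne_zero
  obtain ⟨j, N', hN', hNeq⟩ := Nat.exists_eq_pow_mul_and_not_dvd hN0 p (Fact.out : p.Prime).ne_one
  -- `N'` is a unit of `ℤ_p`
  have hu : IsUnit ((N' : ℕ) : ℤ_[p]) := by
    rw [PadicInt.isUnit_iff, PadicInt.norm_natCast_eq_one_iff]
    exact (Nat.Prime.coprime_iff_not_dvd Fact.out).mpr hN'
  obtain ⟨u, hu'⟩ := hu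
  set S : AddSubgroup ℤ_[p] := (Ideal.span {(p : ℤ_[p]) ^ j}).toAddSubgroup with hS
  set T : AddSubgroup G := AddCommGroup.torsion G with hT
  haveI : Finite T := finite_torsion E φ
  -- (1) `S ≤ range f`
  have hSle : S ≤ f.range := by
    intro y hy
    obtain ⟨z, rfl⟩ := (mem_span_pow_iff j y).mp hy
    refine ⟨((φ.symm (((u⁻¹ : ℤ_[p]ˣ) : ℤ_[p]) * z) : E) : G), ?_⟩
    rw [hf, psi_apply_of_mem E φ (φ.symm _).2]
    simp only [Subtype.coe_eta, AddEquiv.apply_symm_apply]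
    rw [← hN, hNeq, Nat.cast_mul, Nat.cast_pow, ← hu']
    rw [mul_assoc, ← mul_assoc (u : ℤ_[p]), Units.mul_inv, one_mul]
  -- (2) `range f` has `p`-power index
  have hSidx : S.index = p ^ j := index_span_pow j
  obtain ⟨i, hij, hidx⟩ : ∃ i ≤ j, f.range.index = p ^ i :=
    (Nat.dvd_prime_pow (Fact.out : p.Prime)).mp (hSidx ▸ AddSubgroup.index_dvd_of_le hSle)
  -- (3) `S.comap f = E ⊔ T`
  have hcomap : S.comap f = E ⊔ T := by
    apply le_antisymm
    · intro g hg
      rw [AddSubgroup.mem_comap] at hg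
      -- a preimage `e'` of `f g` inside `E`
      obtain ⟨z, hz⟩ := (mem_span_pow_iff j _).mp hg
      set e' : G := ((φ.symm (((u⁻¹ : ℤ_[p]ˣ) : ℤ_[p]) * z) : E) : G) with he'
      have hfe' : f e' = f g := by
        rw [hz, hf, psi_apply_of_mem E φ (φ.symm _).2]
        simp only [Subtype.coe_eta, AddEquiv.apply_symm_apply]
        rw [← hN, hNeq, Nat.cast_mul, Nat.cast_pow, ← hu', mul_assoc, ← mul_assoc (u : ℤ_[p]),
          Units.mul_inv, one_mul]
      have hker : f (g - e') = 0 := by rw [map_sub, hfe', sub_self]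
      have htor : g - e' ∈ T := (psi_eq_zero_iff E φ _).mp hker
      rw [AddSubgroup.mem_sup]
      exact ⟨e', (φ.symm _).2, g - e', htor, by abel⟩
    · refine sup_le ?_ ?_
      · intro e he
        rw [AddSubgroup.mem_comap, hf, psi_apply_of_mem E φ he, ← hN, hNeq, mem_span_pow_iff]
        exact ⟨(N' : ℤ_[p]) * φ ⟨e, he⟩, by push_cast; ring⟩
      · intro t ht
        rw [AddSubgroup.mem_comap, (psi_eq_zero_iff E φ t).mpr ht]
        exact S.zero_mem
  -- (4) counting
  have h1 : (S.comap f).index = S.relIndex f.range := AddSubgroup.index_comap S f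
  have h2 : S.relIndex f.range * f.range.index = S.index := AddSubgroup.relIndex_mul_index hSle
  have h3 : E.relIndex (E ⊔ T) * (E ⊔ T).index = E.index := AddSubgroup.relIndex_mul_index le_sup_left
  have h4 : E.relIndex (E ⊔ T) = E.relIndex T := AddSubgroup.relIndex_sup_left _ _
  have h5 : Nat.card (E.addSubgroupOf T) * E.relIndex T = Nat.card T := AddSubgroup.card_mul_index _
  have h6 : Nat.card (E.addSubgroupOf T) = 1 := by
    rw [hT, addSubgroupOf_torsion_eq_bot E φ]; exact AddSubgroup.card_bot
  rw [h6, one_mul] at h5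
  -- `N = #T · [G : E ⊔ T]` and `[G : E ⊔ T] · p^i = p^j`
  have hA : Nat.card T * (E ⊔ T).index = N := by rw [← h5, ← h4, h3]
  have hB : (E ⊔ T).index * p ^ i = p ^ j := by rw [← hcomap, h1, ← hidx, h2, hSidx]
  -- hence `#T · p^j = N · p^i·`, i.e. `#T = N' p^i`
  have hC : Nat.card T * p ^ j = p ^ j * N' * p ^ i := by
    rw [← hNeq, ← hA, mul_assoc, hB]
  have hD : Nat.card T = N' * p ^ i := by
    have hpj : 0 < p ^ j := pow_pos (Fact.out : p.Prime).pos j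
    apply Nat.eq_of_mul_eq_mul_right hpj
    rw [hC]; ring
  -- `p ∤ #T` forces `i = 0`
  have hi : i = 0 := by
    by_contra hi
    apply not_dvd_card_torsion hiv
    rw [← hT, hD]
    exact dvd_mul_of_dvd_right (dvd_pow_self p hi) N'
  rw [hi, pow_zero, AddSubgroup.index_eq_one] at hidx
  exact AddMonoidHom.range_eq_top.mp hidx

include hiv in
/-- **The index formula**: for `Q ∈ G` of infinite order and every `k`,
`[G : p^k G + ℤQ] = p^{min(k, v_p(Ψ Q))}` — through `Ψ`, `G/(p^kG + ℤQ) ≅ ℤ_p/(p^kℤ_p + ℤΨ(Q))`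
(`ker Ψ =` torsion `⊆ p^k G`). [folklore] -/
theorem index_range_nsmul_sup_zmultiples_eq (Q : G) (hQ : ¬ IsOfFinAddOrder Q) (k : ℕ) :
    ((nsmulAddMonoidHom (p ^ k) : G →+ G).range ⊔ AddSubgroup.zmultiples Q).index =
      p ^ min k (psi E φ Q).valuation := by
  set f := psi E φ with hf
  set I := (nsmulAddMonoidHom (p ^ k) : G →+ G).range ⊔ AddSubgroup.zmultiples Q with hI
  have hsurj := psi_surjective E φ hiv
  have hx : f Q ≠ 0 := fun h ↦ hQ ((psi_eq_zero_iff E φ Q).mp h)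
  -- `ker f ≤ I`
  have hker : f.ker ≤ I := by
    intro g hg
    exact AddSubgroup.mem_sup_left
      (mem_range_nsmul_pow_of_isOfFinAddOrder hiv k ((psi_eq_zero_iff E φ g).mp hg))
  -- `I.index = (I.map f).index`
  have h1 : (I.map f).index = (I ⊔ f.ker).index * f.range.index := AddSubgroup.index_map I f
  rw [sup_eq_left.mpr hker, AddMonoidHom.range_eq_top.mpr hsurj, AddSubgroup.index_top, mul_one] at h1
  rw [← h1]
  -- `I.map f = p^k ℤ_p + ℤ f(Q)`
  have h2 : I.map f = (nsmulAddMonoidHom (p ^ k) : ℤ_[p] →+ ℤ_[p]).range ⊔ AddSubgroup.zmultiples (f Q) := by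
    rw [hI, AddSubgroup.map_sup, AddMonoidHom.map_zmultiples]
    congr 1
    apply le_antisymm
    · rintro _ ⟨_, ⟨g, rfl⟩, rfl⟩
      exact ⟨f g, by rw [nsmulAddMonoidHom_apply, nsmulAddMonoidHom_apply, map_nsmul]⟩
    · rintro _ ⟨y, rfl⟩
      obtain ⟨g, rfl⟩ := hsurj y
      exact ⟨(p ^ k) • g, ⟨g, rfl⟩, by rw [nsmulAddMonoidHom_apply, map_nsmul]⟩
  rw [h2, index_range_nsmul_sup_zmultiples hx]

end Surj

end Summit.BirchSwinnertonDyer.Rank1Residual.X11b.LocalIndex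

end
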